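import Mathlib
import Literature.Analysis.FluidPDE.ConstantinODELemma

/-!
# Host preparation, V: the time profiles (ramp, viscous decay with switch-on, fade of the force)

Cell `ns-blowup`, seat `ns-blowup-ecbridge-3` (g0); GROUP C «BRIDGE SUPPORT» of the route
`PalasekTowerBreakdown` (crux `EpisodeBaseG`, item stmt-NavierStokesRegularity-19179, BC3 stub
`host_preparation` = the tree Prop `RungG 0`). LABEL: E–C typing (KERNEL construction). WHAT THIS
IS NOT: not Navier–Stokes evidence — one-variable calculus of three explicit smooth profiles.

The level-`0` host is `u(t) = a₀ ramp(t) • (bump field) + b₀ decay(t) • (packet)`, its force the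
Navier–Stokes residual multiplied by the time cut-off `fade`. This file supplies the three scalar
profiles, all built from Mathlib's `Real.smoothTransition` (`C^∞`, `0` on `(-∞, 0]`, `1` on
`[1, ∞)`, strictly between in between):

* §1 `ramp = smoothTransition`: `0` before `0`, `1` from `1` on, `< 1` before `1`, in `[0, 1]`,
  with `deriv ramp t = 0` for `t ≤ 0` and for `t ≥ 1` (global extrema);
* §2 `decay λ δ t = exp(−λ²(t−1)) · smoothTransition((t − (1−δ)) · (2/δ))`: `0` before `1 − δ`,
  EXACT VISCOUS DECAY `exp(−λ²(t−1))` from `1 − δ/2` on (so `deriv decay + λ² decay = 0` there —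
  the strong-Beltrami packet solves the heat part of Navier–Stokes exactly), `decay 1 = 1`,
  `0 ≤ decay ≤ exp(λ²δ)` before `1` and `0 < decay ≤ 1` after; with `δ = 1/(4λ²)` the overshoot is
  `exp(1/4) ≤ 3/2` (the tree's `exp_one_quarter_le`);
* §3 `fade τ₁ w t = smoothTransition((τ₁ − t)/w)`: `1` up to `τ₁ − w`, `0` from `τ₁` on, in
  `[0, 1]` — switches the force off inside the growth window so that the schedule is QUIET.

References: S. Palasek, arXiv:2605.13827 §3.3 (switching profiles `ρ_k`) [cite: Palasek2026ElementaryModel, §3.3];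
A. J. Majda, A. L. Bertozzi, *Vorticity and Incompressible Flow* (CUP 2002), §2.3.2 p. 61
(viscous decay `e^{−λ²νt}` of strong Beltrami flows) [cite: MajdaBertozziCUP2002, §2.3.2].
-/

noncomputable section

namespace Summit.NavierStokesRegularity.FluidComputer.PalasekTowerClayBridge.Host

open Real Set Function Filter Topology
open scoped ContDiff Topology

/-! ## §1 The ramp -/

/-- **The ramp** `0 → 1` on `[0, 1]` (Mathlib's smooth transition). [folklore] -/
def ramp (t : ℝ) : ℝ := Real.smoothTransition t

/-- The ramp is smooth. [folklore] -/
theorem contDiff_ramp : ContDiff ℝ ∞ ramp := Real.smoothTransition.contDiff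

/-- The ramp is differentiable. [folklore] -/
theorem differentiable_ramp : Differentiable ℝ ramp := contDiff_ramp.differentiable (by simp)

/-- `ramp t = 0` for `t ≤ 0`. [folklore] -/
theorem ramp_of_nonpos {t : ℝ} (ht : t ≤ 0) : ramp t = 0 := Real.smoothTransition.zero_of_nonpos ht

/-- `ramp t = 1` for `t ≥ 1`. [folklore] -/
theorem ramp_of_one_le {t : ℝ} (ht : 1 ≤ t) : ramp t = 1 := Real.smoothTransition.one_of_one_le ht

/-- `ramp 1 = 1`. [folklore] -/
theorem ramp_one : ramp 1 = 1 := ramp_of_one_le le_rfl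

/-- `0 ≤ ramp`. [folklore] -/
theorem ramp_nonneg (t : ℝ) : 0 ≤ ramp t := Real.smoothTransition.nonneg t

/-- `ramp ≤ 1`. [folklore] -/
theorem ramp_le_one (t : ℝ) : ramp t ≤ 1 := Real.smoothTransition.le_one t

/-- `ramp t < 1` for `t < 1`. [folklore] -/
theorem ramp_lt_one {t : ℝ} (ht : t < 1) : ramp t < 1 := Real.smoothTransition.lt_one_of_lt_one ht

/-- `deriv ramp t = 0` for `t ≥ 1` (a global maximum). [folklore] -/
theorem deriv_ramp_of_one_le {t : ℝ} (ht : 1 ≤ t) : deriv ramp t = 0 := by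
  refine IsLocalMax.deriv_eq_zero (Filter.Eventually.of_forall fun s => ?_)
  rw [ramp_of_one_le ht]
  exact ramp_le_one s

/-- `deriv ramp t = 0` for `t ≤ 0` (a global minimum). [folklore] -/
theorem deriv_ramp_of_nonpos {t : ℝ} (ht : t ≤ 0) : deriv ramp t = 0 := by
  refine IsLocalMin.deriv_eq_zero (Filter.Eventually.of_forall fun s => ?_)
  rw [ramp_of_nonpos ht]
  exact ramp_nonneg s

/-! ## §2 The viscous decay with a smooth switch-on -/

/-- **The viscous decay profile with switch-on**:
`decay λ δ t = exp(−λ²(t−1)) · smoothTransition((t − (1−δ)) · (2/δ))`. [folklore] -/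
def decay (lam δ t : ℝ) : ℝ :=
  Real.exp (-(lam ^ 2) * (t - 1)) * Real.smoothTransition ((t - (1 - δ)) * (2 / δ))

section Decay

variable {lam δ : ℝ}

/-- The pure exponential `exp(−λ²(t−1))` is smooth. [folklore] -/
theorem contDiff_expProfile (lam : ℝ) : ContDiff ℝ ∞ fun t : ℝ => Real.exp (-(lam ^ 2) * (t - 1)) :=
  Real.contDiff_exp.comp (contDiff_const.mul (contDiff_id.sub contDiff_const))

/-- The decay profile is smooth. [folklore] -/
theorem contDiff_decay (lam δ : ℝ) : ContDiff ℝ ∞ (decay lam δ) :=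
  (contDiff_expProfile lam).mul
    (Real.smoothTransition.contDiff.comp ((contDiff_id.sub contDiff_const).mul contDiff_const))

/-- The decay profile is differentiable. [folklore] -/
theorem differentiable_decay (lam δ : ℝ) : Differentiable ℝ (decay lam δ) :=
  (contDiff_decay lam δ).differentiable (by simp)

/-- Before the switch-on (`t ≤ 1 − δ`, `δ > 0`) the profile vanishes. [folklore] -/
theorem decay_of_le (hδ : 0 < δ) {t : ℝ} (ht : t ≤ 1 - δ) : decay lam δ t = 0 := by
  have h : (t - (1 - δ)) * (2 / δ) ≤ 0 :=
    mul_nonpos_of_nonpos_of_nonneg (by linarith) (by positivity)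
  rw [decay, Real.smoothTransition.zero_of_nonpos h, mul_zero]

/-- Before the switch-on the profile has zero derivative (`t < 1 − δ`). [folklore] -/
theorem deriv_decay_of_lt (hδ : 0 < δ) {t : ℝ} (ht : t < 1 - δ) : deriv (decay lam δ) t = 0 := by
  have hev : decay lam δ =ᶠ[𝓝 t] fun _ => (0 : ℝ) := by
    filter_upwards [gt_mem_nhds ht] with s hs
    exact decay_of_le hδ hs.le
  rw [hev.deriv_eq, deriv_const]

/-- After the switch-on (`1 − δ/2 ≤ t`, `δ > 0`) the profile is the exact exponential. [folklore] -/
theorem decay_of_ge (hδ : 0 < δ) {t : ℝ} (ht : 1 - δ / 2 ≤ t) :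
    decay lam δ t = Real.exp (-(lam ^ 2) * (t - 1)) := by
  have h : 1 ≤ (t - (1 - δ)) * (2 / δ) := by
    rw [le_mul_div_iff₀' hδ]
    · linarith
  rw [decay, Real.smoothTransition.one_of_one_le h, mul_one]
where
  /-- `1 ≤ a * (2/δ) ↔ δ ≤ a * 2` for `δ > 0`, in the form needed. [folklore] -/
  le_mul_div_iff₀' {a : ℝ} (hδ : 0 < δ) : (1 : ℝ) ≤ a * (2 / δ) ↔ δ / 2 ≤ a := by
    rw [mul_div_assoc', le_div_iff₀ hδ, div_le_iff₀ (by norm_num : (0 : ℝ) < 2)]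
    constructor <;> intro h <;> linarith

/-- `decay 1 = 1` (`δ > 0`). [folklore] -/
theorem decay_one (hδ : 0 < δ) : decay lam δ 1 = 1 := by
  rw [decay_of_ge hδ (by linarith)]
  simp

/-- **Exact viscous decay after the switch-on**: `deriv decay t = −λ² · decay t` for `t > 1 − δ/2`.
[cite: MajdaBertozziCUP2002, §2.3.2] -/
theorem deriv_decay_of_gt (hδ : 0 < δ) {t : ℝ} (ht : 1 - δ / 2 < t) :
    deriv (decay lam δ) t = -(lam ^ 2) * decay lam δ t := by
  have hev : decay lam δ =ᶠ[𝓝 t] fun s => Real.exp (-(lam ^ 2) * (s - 1)) := by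
    filter_upwards [lt_mem_nhds ht] with s hs
    exact decay_of_ge hδ hs.le
  rw [hev.deriv_eq, decay_of_ge hδ ht.le]
  have h1 : HasDerivAt (fun s : ℝ => -(lam ^ 2) * (s - 1)) (-(lam ^ 2)) t := by
    simpa using ((hasDerivAt_id t).sub_const 1).const_mul (-(lam ^ 2))
  rw [h1.exp.deriv]
  ring

/-- Hence `deriv decay + λ² decay = 0` from `t = 1` on. [folklore] -/
theorem deriv_decay_add (hδ : 0 < δ) {t : ℝ} (ht : 1 ≤ t) :
    deriv (decay lam δ) t + lam ^ 2 * decay lam δ t = 0 := by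
  rw [deriv_decay_of_gt hδ (by linarith)]
  ring

/-- The profile is nonnegative. [folklore] -/
theorem decay_nonneg (t : ℝ) : 0 ≤ decay lam δ t :=
  mul_nonneg (Real.exp_pos _).le (Real.smoothTransition.nonneg _)

/-- From `t = 1` on the profile is positive (`δ > 0`). [folklore] -/
theorem decay_pos (hδ : 0 < δ) {t : ℝ} (ht : 1 ≤ t) : 0 < decay lam δ t := by
  rw [decay_of_ge hδ (by linarith)]
  exact Real.exp_pos _

/-- From `t = 1` on the profile is at most `1`. [folklore] -/
theorem decay_le_one {t : ℝ} (ht : 1 ≤ t) : decay lam δ t ≤ 1 := by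
  unfold decay
  have h1 : Real.exp (-(lam ^ 2) * (t - 1)) ≤ 1 := by
    rw [Real.exp_le_one_iff]
    nlinarith [sq_nonneg lam]
  exact mul_le_one₀ h1 (Real.smoothTransition.nonneg _) (Real.smoothTransition.le_one _)

/-- **The profile never exceeds `exp(λ²δ)`** (`δ > 0`; the overshoot happens on `[1 − δ, 1]`).
[folklore] -/
theorem decay_le_exp (hδ : 0 < δ) (t : ℝ) : decay lam δ t ≤ Real.exp (lam ^ 2 * δ) := by
  rcases le_or_gt t (1 - δ) with h | h
  · rw [decay_of_le hδ h]
    exact (Real.exp_pos _).le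
  · unfold decay
    have h1 : Real.exp (-(lam ^ 2) * (t - 1)) ≤ Real.exp (lam ^ 2 * δ) := by
      rw [Real.exp_le_exp]
      nlinarith [sq_nonneg lam]
    calc _ ≤ Real.exp (-(lam ^ 2) * (t - 1)) * 1 :=
          mul_le_mul_of_nonneg_left (Real.smoothTransition.le_one _) (Real.exp_pos _).le
      _ ≤ Real.exp (lam ^ 2 * δ) := by rw [mul_one]; exact h1

/-- **With the registered switch-on length `δ = 1/(4λ²)` the profile never exceeds `3/2`**
(`λ ≠ 0`). [folklore] -/
theorem decay_le_three_halves (hlam : lam ≠ 0) (t : ℝ) :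
    decay lam (1 / (4 * lam ^ 2)) t ≤ 3 / 2 := by
  have hδ : 0 < 1 / (4 * lam ^ 2) := by positivity
  refine (decay_le_exp hδ t).trans ?_
  have e : lam ^ 2 * (1 / (4 * lam ^ 2)) = 1 / 4 := by field_simp
  rw [e]
  exact Literature.Analysis.FluidPDE.exp_one_quarter_le

end Decay

/-! ## §3 The fade of the force -/

/-- **The fade** `fade τ₁ w t = smoothTransition((τ₁ − t)/w)`: `1` up to `τ₁ − w`, `0` from `τ₁`.
[cite: Palasek2026ElementaryModel, §3.3] -/
def fade (τ₁ w t : ℝ) : ℝ := Real.smoothTransition ((τ₁ - t) / w)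

section Fade

variable {τ₁ w : ℝ}

/-- The fade is smooth. [folklore] -/
theorem contDiff_fade (τ₁ w : ℝ) : ContDiff ℝ ∞ (fade τ₁ w) :=
  Real.smoothTransition.contDiff.comp ((contDiff_const.sub contDiff_id).div_const w)

/-- `fade t = 1` for `t ≤ τ₁ − w` (`w > 0`). [folklore] -/
theorem fade_of_le (hw : 0 < w) {t : ℝ} (ht : t ≤ τ₁ - w) : fade τ₁ w t = 1 := by
  refine Real.smoothTransition.one_of_one_le ?_
  rw [le_div_iff₀ hw]
  linarith

/-- `fade t = 0` for `t ≥ τ₁`. [folklore] -/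
theorem fade_of_ge (hw : 0 < w) {t : ℝ} (ht : τ₁ ≤ t) : fade τ₁ w t = 0 :=
  Real.smoothTransition.zero_of_nonpos (div_nonpos_of_nonpos_of_nonneg (by linarith) hw.le)

/-- `0 ≤ fade`. [folklore] -/
theorem fade_nonneg (t : ℝ) : 0 ≤ fade τ₁ w t := Real.smoothTransition.nonneg _

/-- `fade ≤ 1`. [folklore] -/
theorem fade_le_one (t : ℝ) : fade τ₁ w t ≤ 1 := Real.smoothTransition.le_one _

/-- `|fade| ≤ 1`. [folklore] -/
theorem abs_fade_le_one (t : ℝ) : |fade τ₁ w t| ≤ 1 := by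
  rw [abs_of_nonneg (fade_nonneg t)]
  exact fade_le_one t

end Fade

end Summit.NavierStokesRegularity.FluidComputer.PalasekTowerClayBridge.Host

end
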